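import Summits.Ventures.YMGap.Thresholds.TruncatedTreeDecay
import HarnessLib

/-!
# Venture YMGap — C-SMOOTH (ii): THE STRONG-COUPLING STATE IS `C^∞` IN THE COUPLING, with
# `dⁿ/dβ_Wⁿ ⟨F⟩_{β_W} = Σ_{q₁…q_n} u_{n+1}(F; W_{q₁}; …; W_{q_n})` (`SU(2)`, `d = 4`, every `0 < β_W < 9/25`)

HONEST FRAMING: venture file of the cell `pub-ymgap` (QuantumFields programme), seat ds-1 (gen 12).  Strong-coupling
LATTICE statement for `SU(2)` lattice Yang–Mills on `ℤ^4` with the Wilson action inside the one-sided vertex-star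
window `0 ≤ β_W ≤ 9/25` (tree bare coupling `β_W/2`, `W_q = ½ Re tr U_q`): the (unique) DLR state is INFINITELY
differentiable in the coupling on Lipschitz cylinder observables, and the `n`-th derivative is the absolutely convergent
`n`-fold plaquette sum of the connected `(n+1)`-point function; `C^∞`, NOT analyticity (the constants of
`TruncatedTreeDecay` grow much faster than `n!`); the window is where the vertex-star bound closes, not a transition;
nothing about the continuum, confinement at weak coupling, or the Clay problem.  This closes the regularity ladder of
the cell (`C¹` g8 `CouplingDerivative`, `C²` g10 `CouplingSecondDerivative`, `C³`/`C⁴` staged) in one theorem.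
Mechanism: g8's C-DIFF for every product cylinder (`su2_hasDerivAt_integral_star`), the chain rule and the
fresh-slot identity of the anchored cumulants (`hasDerivAt_ac`, `dac_tsum`, `dac_eq_ac_insert`:
`d/dβ_W u_{n+1}(F; W_{q₁..q_n}) = Σ_r u_{n+2}(F; W_{q₁..q_n}; W_r)`), the all-orders tree-decay domination
(`su2_summable_truncated`, `su2_tsum_abs_truncated_snoc_le`) and termwise differentiation
(`hasDerivAt_tsum_of_isPreconnected`).

For `β₁ ≤ 9/25`, any DLR selection `μ` on `[0, β₁]`, a Lipschitz cylinder `F` (support within `D` of `x₀`):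
* `su2_slots_prod` — every product of slots of `(F; W_{q 0}; …)` is a Lipschitz cylinder near `x₀`;
* ★ `su2_hasDerivAt_trunc` — `d/dβ_W u_{n+1}(F; W_{q 0}; …; W_{q (n−1)})_{β_W} = Σ_r u_{n+2}(…; W_r)_{β_W}`;
* ★★ `su2_hasDerivAt_truncSum` — the order-`n` response series `R_n(β_W) = Σ_{q} u_{n+1}(F; W_q…)_{β_W}` is
  differentiable on `(0, β₁)` with `R_n' = R_{n+1}` (`TruncatedTools.tsum_snoc_eq`: `Σ_q Σ_r = Σ_{q'}`);
* ★★ `su2_iteratedDeriv_integral_eq` — `(d/dβ_W)ⁿ ⟨F⟩_{β_W} = R_n(β_W)` at every `0 < β_W < β₁`, every `n`;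
* ★★★ `su2_contDiffOn_infty_integral_star` / `_9_25` — `β_W ↦ ⟨F⟩_{β_W}` is `ContDiffOn ℝ ∞` on `Ioo 0 β₁`;
  `su2_contDiffOn_infty_truncSum` — so is every response series `R_n` (all higher susceptibilities);
  `su2_contDiffOn_infty_plaquette_9_25` — the mean plaquette is `C^∞` on `(0, 9/25)`: no finite-order transition of the
  lattice internal energy inside the window, as a kernel theorem (the pressure: sibling file `PressureSmooth`).

References (mechanism only): M. Duneau, D. Iagolnitzer, B. Souillard, CMP 31 (1973) 191; B. Simon, *The Statistical
Mechanics of Lattice Gases* I (1993), §II.12; R. L. Dobrushin, S. B. Shlosman (1987) (complete analyticity would give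
analyticity; here `C^∞` from the vertex-star bound).
-/

noncomputable section

open MeasureTheory ProbabilityTheory Function Finset Filter Topology Real Set
open scoped NNReal ContDiff
open Literature.MathematicalPhysics.QuantumLattice (LGConfig ZdEdge ZdPlaquette plaquetteEdges fundamentalRep
  ymGibbsMeasures)
open Literature.MathematicalPhysics.QuantumFieldTheory hiding ZdEdge
open Literature.Probability.LatticeModels (Site Site.supNorm Site.norm_eq_supNorm)
open Summit.Ventures.YMGap.RobustBall (l1 numOrient)
open Summit.Ventures.YMGap.Cumulants

namespace Summit.Ventures.YMGap.CouplingResponse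

/-- Local shorthand: the normalised plaquette observable `W_q = ½ Re tr U_q` of `SU(2)` on `ℤ⁴`, as a family. -/
local notation3 (prettyPrint := false) "𝓦" =>
  fun q : ZdPlaquette 4 => zdPlaquetteObs (d := 4) (fundamentalRep (Fin 2)) (Prod.fst q) (Prod.snd q).1.1 (Prod.snd q).1.2

/-! ### §1 Products of slots are Lipschitz cylinders near `x₀` -/

/-- **Every product of slots of `(F; W_{q 0}; …; W_{q (n−1)})` is a bounded Lipschitz cylinder supported near `x₀`**
(some support, constant and radius — only their existence is used downstream). -/
theorem su2_slots_prod {F : LGConfig 4 (Matrix.specialUnitaryGroup (Fin 2) ℂ) → ℝ} {Λ : Finset (ZdEdge 4)} {K : ℝ≥0}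
    (hF : IsLipschitzCylinder (fundamentalRep (Fin 2)) F Λ K)
    {x₀ : Site 4} {D : ℕ} (hD : ∀ e ∈ Λ, ‖e.1 - x₀‖ ≤ D) {n : ℕ} (q : Fin n → ZdPlaquette 4) (T : Finset ℕ) :
    ∃ (ΛT : Finset (ZdEdge 4)) (KT MT : ℝ≥0) (DT : ℕ),
      IsLipschitzCylinder (fundamentalRep (Fin 2)) (fun U => ∏ i ∈ T, slots F 𝓦 q i U) ΛT KT ∧
      (∀ U, |∏ i ∈ T, slots F 𝓦 q i U| ≤ MT) ∧ ∀ e ∈ ΛT, ‖e.1 - x₀‖ ≤ DT := by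
  classical
  choose Λs cs hL hM hc hnear hcs0 hcsq using su2_slot_data hF hD q
  have hB : (1 : ℝ≥0) ≤ ‖F 1‖₊ + 2 * K + 1 := le_add_self
  obtain ⟨hLT, hBT⟩ := isLipschitzCylinder_prod hB T (fun i _ => hL i) (fun i _ => hM i)
  refine ⟨T.biUnion Λs, _, _, D + 1 + ∑ i ∈ T, Site.supNorm (cs i - x₀), hLT, hBT, fun e he => ?_⟩
  obtain ⟨i, hi, hei⟩ := Finset.mem_biUnion.1 he
  have h1 := hnear i e hei
  have h2 : ‖cs i - x₀‖ ≤ ((∑ j ∈ T, Site.supNorm (cs j - x₀) : ℕ) : ℝ) := by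
    rw [Site.norm_eq_supNorm]
    exact_mod_cast Finset.single_le_sum (f := fun j => Site.supNorm (cs j - x₀)) (fun j _ => Nat.zero_le _) hi
  calc ‖e.1 - x₀‖ = ‖(e.1 - cs i) + (cs i - x₀)‖ := by congr 1; abel
    _ ≤ ‖e.1 - cs i‖ + ‖cs i - x₀‖ := norm_add_le _ _
    _ ≤ _ := by push_cast at h1 h2 ⊢; linarith

/-! ### §2 The derivative of a truncated function is the next truncated function, summed over the new plaquette -/

/-- ★ **`d/dβ_W u_{n+1}(F; W_{q 0}; …; W_{q (n−1)})_{μ β_W} = Σ_r u_{n+2}(F; W_{q 0}; …; W_{q (n−1)}; W_r)_{μ β_W}`**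
(`SU(2)`, `d = 4`, every `0 < β_W < β₁ ≤ 9/25`, any DLR selection): each moment of the slot family is `C¹` with
derivative the response series of the product cylinder (g8's `su2_hasDerivAt_integral_star`), the chain rule
`hasDerivAt_ac` turns this into `dac`, `dac_tsum` pulls the plaquette sum out, and the fresh-slot identity
`dac_eq_ac_insert` identifies each term with the truncated function of the family extended by `W_r`. -/
theorem su2_hasDerivAt_trunc {β₁ : ℝ} (h1 : β₁ ≤ 9 / 25)
    {μ : ℝ → Measure (LGConfig 4 (Matrix.specialUnitaryGroup (Fin 2) ℂ))}
    (hμ : ∀ βW ∈ Icc (0 : ℝ) β₁, μ βW ∈ ymGibbsMeasures (d := 4) (fundamentalRep (Fin 2)) (2 * (βW / 4)))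
    {F : LGConfig 4 (Matrix.specialUnitaryGroup (Fin 2) ℂ) → ℝ} {Λ : Finset (ZdEdge 4)} {K : ℝ≥0}
    (hF : IsLipschitzCylinder (fundamentalRep (Fin 2)) F Λ K)
    {x₀ : Site 4} {D : ℕ} (hD : ∀ e ∈ Λ, ‖e.1 - x₀‖ ≤ D) {n : ℕ} (q : Fin n → ZdPlaquette 4)
    {βW : ℝ} (hb : βW ∈ Ioo (0 : ℝ) β₁) :
    HasDerivAt (fun t => trunc (μ t) F 𝓦 q)
      (∑' r : ZdPlaquette 4, trunc (μ βW) F 𝓦 (Fin.snoc q r : Fin (n + 1) → ZdPlaquette 4)) βW := by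
  classical
  have hbI : βW ∈ Icc (0 : ℝ) β₁ := ⟨hb.1.le, hb.2.le⟩
  haveI : IsProbabilityMeasure (μ βW) := (hμ βW hbI).1
  set S : Finset ℕ := Finset.range (n + 1) with hS
  set X := slots F 𝓦 q with hX
  -- data of the product cylinders
  choose ΛT KT MT DT hLT hMT hDT using su2_slots_prod hF hD q
  -- the moments are `C¹` with derivative the response series
  set m' : Finset ℕ → ℝ := fun T => ∑' r : ZdPlaquette 4, cov[fun U => ∏ i ∈ T, X i U, 𝓦 r; μ βW] with hm'
  have hmom : ∀ T ⊆ S, HasDerivAt (fun t => mom (μ t) X T) (m' T) βW := fun T _ =>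
    su2_hasDerivAt_integral_star h1 hμ (hLT T) (hDT T) hb
  have hder := hasDerivAt_ac hmom 0 S subset_rfl
  refine hder.congr_deriv ?_
  -- summability of each response series, and `dac` through the sum
  set m'r : ZdPlaquette 4 → Finset ℕ → ℝ := fun r T => cov[fun U => ∏ i ∈ T, X i U, 𝓦 r; μ βW] with hm'r
  have hs : ∀ T ⊆ S, Summable fun r => m'r r T := fun T _ =>
    su2_summable_cov_plaquette_star h1 hbI.1 hbI.2 (hμ βW hbI) (hLT T) (hDT T)
  obtain ⟨-, hsum⟩ := dac_tsum (m := mom (μ βW) X) hs 0 S subset_rfl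
  have em' : (fun T => ∑' r, m'r r T) = m' := rfl
  rw [em'] at hsum
  rw [← hsum]
  refine tsum_congr fun r => ?_
  -- the fresh-slot identity for the plaquette `r` in slot `n + 1`
  obtain ⟨hWr, hWrm, hWr1, -, -⟩ := su2_plaquetteObs_data r
  set M : Finset ℕ → ℝ := mom (μ βW) (slots F 𝓦 (Fin.snoc q r : Fin (n + 1) → ZdPlaquette 4)) with hM
  have hsS : n + 1 ∉ S := by simp [hS]
  have hagree : ∀ i ∈ S, slots F 𝓦 (Fin.snoc q r : Fin (n + 1) → ZdPlaquette 4) i = X i := fun i hi =>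
    slots_snoc_of_le F _ q r (Nat.lt_succ_iff.1 (Finset.mem_range.1 hi))
  have hMm : ∀ T ⊆ S, M T = mom (μ βW) X T := mom_congr (μ βW) hagree
  have hlast := slots_snoc_last F (fun p : ZdPlaquette 4 => zdPlaquetteObs (d := 4) (fundamentalRep (Fin 2)) p.1 p.2.1.1 p.2.1.2) q r
  have hm'M : ∀ T ⊆ S, m'r r T = M (insert (n + 1) T) - mom (μ βW) X T * M {n + 1} := by
    intro T hTS
    have hsT : n + 1 ∉ T := fun h => hsS (hTS h)
    have e1 : M (insert (n + 1) T) = ∫ U, (∏ i ∈ T, X i U) * (𝓦 r) U ∂(μ βW) := by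
      simp only [hM, mom]
      refine integral_congr_ae (ae_of_all _ fun U => ?_)
      dsimp only
      rw [Finset.prod_insert hsT, hlast, mul_comm]
      congr 1
      exact Finset.prod_congr rfl fun i hi => by rw [hagree i (hTS hi)]
    have e2 : M {n + 1} = ∫ U, (𝓦 r) U ∂(μ βW) := by
      simp only [hM, mom, Finset.prod_singleton]
      refine integral_congr_ae (ae_of_all _ fun U => ?_)
      rw [hlast]
    rw [e1, e2, hm'r]
    exact covariance_eq_sub_of_abs_le (hLT T).measurable hWrm (hMT T) hWr1
  have key := dac_eq_ac_insert (a := 0) hsS hMm hm'M S subset_rfl (Finset.mem_range.2 (Nat.succ_pos n))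
  rw [key]
  show ac M 0 (insert (n + 1) (Finset.range (n + 1))) = ac M 0 (Finset.range (n + 1 + 1))
  rw [← Finset.range_add_one]

/-! ### §3 The response series of every order is differentiable, `R_n' = R_{n+1}` -/

/-- ★★ **THE ORDER-`n` RESPONSE SERIES IS DIFFERENTIABLE IN THE COUPLING, WITH DERIVATIVE THE ORDER-`(n+1)` SERIES**
(`SU(2)`, `d = 4`, hypothesis-free): for `β₁ ≤ 9/25`, any DLR selection `μ` on `[0, β₁]`, every Lipschitz cylinder `F`,
every `n` and every `0 < β_W < β₁`:
`d/dβ_W Σ_{q} u_{n+1}(F; W_{q 0}; …; W_{q (n−1)})_{μ β_W} = Σ_{q'} u_{n+2}(F; W_{q' 0}; …; W_{q' n})_{μ β_W}`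
(termwise differentiation `hasDerivAt_tsum_of_isPreconnected` under the fibre domination
`su2_tsum_abs_truncated_snoc_le`, summability `su2_summable_truncated`, re-indexing `tsum_snoc_eq`). -/
theorem su2_hasDerivAt_truncSum {β₁ : ℝ} (h1 : β₁ ≤ 9 / 25)
    {μ : ℝ → Measure (LGConfig 4 (Matrix.specialUnitaryGroup (Fin 2) ℂ))}
    (hμ : ∀ βW ∈ Icc (0 : ℝ) β₁, μ βW ∈ ymGibbsMeasures (d := 4) (fundamentalRep (Fin 2)) (2 * (βW / 4)))
    {F : LGConfig 4 (Matrix.specialUnitaryGroup (Fin 2) ℂ) → ℝ} {Λ : Finset (ZdEdge 4)} {K : ℝ≥0}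
    (hF : IsLipschitzCylinder (fundamentalRep (Fin 2)) F Λ K)
    {x₀ : Site 4} {D : ℕ} (hD : ∀ e ∈ Λ, ‖e.1 - x₀‖ ≤ D) (n : ℕ) {βW : ℝ} (hb : βW ∈ Ioo (0 : ℝ) β₁) :
    HasDerivAt (fun t => ∑' q : Fin n → ZdPlaquette 4, trunc (μ t) F 𝓦 q)
      (∑' q : Fin (n + 1) → ZdPlaquette 4, trunc (μ βW) F 𝓦 q) βW := by
  classical
  have hbI : βW ∈ Icc (0 : ℝ) β₁ := ⟨hb.1.le, hb.2.le⟩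
  obtain ⟨A, ρ, hA0, hρ0, hρ1, hdom⟩ := su2_tsum_abs_truncated_snoc_le h1 hF hD n
  obtain ⟨A₀, ρ₀, -, -, -, hsum0⟩ := su2_summable_truncated h1 hF hD n
  obtain ⟨A₁, ρ₁, -, -, -, hsum1⟩ := su2_summable_truncated h1 hF hD (n + 1)
  set Z : ℝ := numOrient 4 * ((1 + ρ) / (1 - ρ)) ^ 4 with hZ
  have hZ0 : 0 ≤ Z := by
    have : 0 < 1 - ρ := by linarith
    positivity
  set u : (Fin n → ZdPlaquette 4) → ℝ := fun q => A * Z * ∏ i, ρ ^ l1 (x₀ - (q i).1) with hu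
  have hu0 : ∀ q, 0 ≤ u q := fun q => mul_nonneg (mul_nonneg hA0 hZ0) (Finset.prod_nonneg fun i _ => pow_nonneg hρ0 _)
  have hus : Summable u :=
    (summable_pi_of_abs_le_prod (f := u) (mul_nonneg hA0 hZ0) (fun r => pow_nonneg hρ0 _)
      (sum_pow_l1_plaquette_le hρ0 hρ1 x₀) (fun q => by rw [abs_of_nonneg (hu0 q)])).1
  have h := hasDerivAt_tsum_of_isPreconnected hus isOpen_Ioo (convex_Ioo (0 : ℝ) β₁).isPreconnected
    (g := fun q t => trunc (μ t) F 𝓦 q)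
    (g' := fun q t => ∑' r : ZdPlaquette 4, trunc (μ t) F 𝓦 (Fin.snoc q r : Fin (n + 1) → ZdPlaquette 4))
    (fun q t ht => su2_hasDerivAt_trunc h1 hμ hF hD q ht) (fun q t ht => ?_) hb
    (hsum0 hbI.1 hbI.2 (hμ βW hbI)).2.1 hb
  · refine h.congr_deriv ?_
    exact (tsum_snoc_eq (hsum1 hbI.1 hbI.2 (hμ βW hbI)).2.1).symm
  · have htI : t ∈ Icc (0 : ℝ) β₁ := ⟨ht.1.le, ht.2.le⟩
    obtain ⟨hs, hle⟩ := hdom htI.1 htI.2 (hμ t htI) q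
    refine (norm_tsum_le_tsum_norm hs.norm).trans ?_
    simpa only [Real.norm_eq_abs, hu, hZ] using hle

/-! ### §4 `C^∞` in the coupling -/

/-- **Order zero of the response series is the mean**: `Σ'_{q : Fin 0 → P} u_1(F) = ⟨F⟩`. -/
theorem tsum_trunc_fin_zero {P : Type*} (μ : Measure (LGConfig 4 (Matrix.specialUnitaryGroup (Fin 2) ℂ)))
    (F : LGConfig 4 (Matrix.specialUnitaryGroup (Fin 2) ℂ) → ℝ)
    (W : P → LGConfig 4 (Matrix.specialUnitaryGroup (Fin 2) ℂ) → ℝ) :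
    ∑' q : Fin 0 → P, trunc μ F W q = ∫ U, F U ∂μ := by
  rw [tsum_fintype, Fintype.sum_unique]
  exact trunc_fin_zero μ F W _

/-- ★★ **THE `n`-TH DERIVATIVE OF THE STATE IS THE ORDER-`n` RESPONSE SERIES** (`SU(2)`, `d = 4`, hypothesis-free):
for `β₁ ≤ 9/25`, any DLR selection `μ` on `[0, β₁]`, every Lipschitz cylinder `F`, every `n` and every `0 < β_W < β₁`:
`(d/dβ_W)ⁿ ⟨F⟩_{μ β_W} = Σ_{q : Fin n → plaquettes} u_{n+1}(F; W_{q 0}; …; W_{q (n−1)})_{μ β_W}`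
(the `n`-fold absolutely convergent plaquette sum of the connected `(n+1)`-point function). -/
theorem su2_iteratedDeriv_integral_eq {β₁ : ℝ} (h1 : β₁ ≤ 9 / 25)
    {μ : ℝ → Measure (LGConfig 4 (Matrix.specialUnitaryGroup (Fin 2) ℂ))}
    (hμ : ∀ βW ∈ Icc (0 : ℝ) β₁, μ βW ∈ ymGibbsMeasures (d := 4) (fundamentalRep (Fin 2)) (2 * (βW / 4)))
    {F : LGConfig 4 (Matrix.specialUnitaryGroup (Fin 2) ℂ) → ℝ} {Λ : Finset (ZdEdge 4)} {K : ℝ≥0}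
    (hF : IsLipschitzCylinder (fundamentalRep (Fin 2)) F Λ K)
    {x₀ : Site 4} {D : ℕ} (hD : ∀ e ∈ Λ, ‖e.1 - x₀‖ ≤ D) (n : ℕ) :
    ∀ ⦃βW : ℝ⦄, βW ∈ Ioo (0 : ℝ) β₁ →
      iteratedDeriv n (fun t => ∫ U, F U ∂(μ t)) βW = ∑' q : Fin n → ZdPlaquette 4, trunc (μ βW) F 𝓦 q := by
  induction n with
  | zero =>
    intro βW _
    rw [iteratedDeriv_zero, tsum_trunc_fin_zero]
  | succ n ih =>
    intro βW hb
    rw [iteratedDeriv_succ]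
    have hev : iteratedDeriv n (fun t => ∫ U, F U ∂(μ t)) =ᶠ[𝓝 βW]
        fun t => ∑' q : Fin n → ZdPlaquette 4, trunc (μ t) F 𝓦 q :=
      Filter.eventually_of_mem (Ioo_mem_nhds hb.1 hb.2) fun t ht => ih ht
    rw [hev.deriv_eq]
    exact (su2_hasDerivAt_truncSum h1 hμ hF hD n hb).deriv

/-- ★★★ **THE STRONG-COUPLING STATE IS `C^∞` IN THE COUPLING** (`SU(2)`, `d = 4`, hypothesis-free): for `β₁ ≤ 9/25`,
any DLR selection `μ` on `[0, β₁]` (forced: the state is unique there) and every Lipschitz cylinder observable `F`,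
`β_W ↦ ⟨F⟩_{μ β_W}` is `ContDiffOn ℝ ∞` on `Ioo 0 β₁` — every response series `R_n` is differentiable with derivative
`R_{n+1}` (`su2_hasDerivAt_truncSum`), `R_0 = ⟨F⟩`.  `C^∞`, NOT analytic. -/
theorem su2_contDiffOn_infty_integral_star {β₁ : ℝ} (h1 : β₁ ≤ 9 / 25)
    {μ : ℝ → Measure (LGConfig 4 (Matrix.specialUnitaryGroup (Fin 2) ℂ))}
    (hμ : ∀ βW ∈ Icc (0 : ℝ) β₁, μ βW ∈ ymGibbsMeasures (d := 4) (fundamentalRep (Fin 2)) (2 * (βW / 4)))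
    {F : LGConfig 4 (Matrix.specialUnitaryGroup (Fin 2) ℂ) → ℝ} {Λ : Finset (ZdEdge 4)} {K : ℝ≥0}
    (hF : IsLipschitzCylinder (fundamentalRep (Fin 2)) F Λ K)
    {x₀ : Site 4} {D : ℕ} (hD : ∀ e ∈ Λ, ‖e.1 - x₀‖ ≤ D) :
    ContDiffOn ℝ ∞ (fun t => ∫ U, F U ∂(μ t)) (Ioo (0 : ℝ) β₁) := by
  classical
  set R : ℕ → ℝ → ℝ := fun n t => ∑' q : Fin n → ZdPlaquette 4, trunc (μ t) F 𝓦 q with hR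
  have hderiv : ∀ n, ∀ t ∈ Ioo (0 : ℝ) β₁, HasDerivAt (R n) (R (n + 1) t) t := fun n t ht =>
    su2_hasDerivAt_truncSum h1 hμ hF hD n ht
  have hall : ∀ N : ℕ, ∀ n, ContDiffOn ℝ N (R n) (Ioo (0 : ℝ) β₁) := by
    intro N
    induction N with
    | zero =>
      intro n
      exact contDiffOn_zero.2 fun t ht => (hderiv n t ht).continuousAt.continuousWithinAt
    | succ N ih =>
      intro n
      rw [show ((N + 1 : ℕ) : WithTop ℕ∞) = (N : WithTop ℕ∞) + 1 by push_cast; rfl,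
        contDiffOn_succ_iff_deriv_of_isOpen isOpen_Ioo]
      refine ⟨fun t ht => (hderiv n t ht).differentiableAt.differentiableWithinAt, fun h => absurd h (by simp), ?_⟩
      exact (ih (n + 1)).congr fun t ht => (hderiv n t ht).deriv
  have hR0 : ∀ t, R 0 t = ∫ U, F U ∂(μ t) := fun t => tsum_trunc_fin_zero (μ t) F _
  exact (contDiffOn_infty.2 fun N => hall N 0).congr fun t _ => (hR0 t).symm

/-- ★★ **EVERY RESPONSE SERIES IS `C^∞`**: for every `n`, the order-`n` response series
`β_W ↦ R_n(β_W) = Σ_q u_{n+1}(F; W_{q 0}; …)_{μ β_W}` (for `n = 1`, `F = W_p`: the plaquette susceptibility; in general the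
higher susceptibilities) is `ContDiffOn ℝ ∞` on `Ioo 0 β₁`. -/
theorem su2_contDiffOn_infty_truncSum {β₁ : ℝ} (h1 : β₁ ≤ 9 / 25)
    {μ : ℝ → Measure (LGConfig 4 (Matrix.specialUnitaryGroup (Fin 2) ℂ))}
    (hμ : ∀ βW ∈ Icc (0 : ℝ) β₁, μ βW ∈ ymGibbsMeasures (d := 4) (fundamentalRep (Fin 2)) (2 * (βW / 4)))
    {F : LGConfig 4 (Matrix.specialUnitaryGroup (Fin 2) ℂ) → ℝ} {Λ : Finset (ZdEdge 4)} {K : ℝ≥0}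
    (hF : IsLipschitzCylinder (fundamentalRep (Fin 2)) F Λ K)
    {x₀ : Site 4} {D : ℕ} (hD : ∀ e ∈ Λ, ‖e.1 - x₀‖ ≤ D) (n : ℕ) :
    ContDiffOn ℝ ∞ (fun t => ∑' q : Fin n → ZdPlaquette 4, trunc (μ t) F 𝓦 q) (Ioo (0 : ℝ) β₁) := by
  classical
  set R : ℕ → ℝ → ℝ := fun n t => ∑' q : Fin n → ZdPlaquette 4, trunc (μ t) F 𝓦 q with hR
  have hderiv : ∀ n, ∀ t ∈ Ioo (0 : ℝ) β₁, HasDerivAt (R n) (R (n + 1) t) t := fun n t ht =>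
    su2_hasDerivAt_truncSum h1 hμ hF hD n ht
  have hall : ∀ N : ℕ, ∀ n, ContDiffOn ℝ N (R n) (Ioo (0 : ℝ) β₁) := by
    intro N
    induction N with
    | zero =>
      intro n
      exact contDiffOn_zero.2 fun t ht => (hderiv n t ht).continuousAt.continuousWithinAt
    | succ N ih =>
      intro n
      rw [show ((N + 1 : ℕ) : WithTop ℕ∞) = (N : WithTop ℕ∞) + 1 by push_cast; rfl,
        contDiffOn_succ_iff_deriv_of_isOpen isOpen_Ioo]
      refine ⟨fun t ht => (hderiv n t ht).differentiableAt.differentiableWithinAt, fun h => absurd h (by simp), ?_⟩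
      exact (ih (n + 1)).congr fun t ht => (hderiv n t ht).deriv
  exact contDiffOn_infty.2 fun N => hall N n

/-- ★★★ **The instance `β₁ = 9/25`**: `β_W ↦ ⟨F⟩_{β_W}` is `C^∞` on `(0, 9/25) = (0, 0.36)` ('t Hooft `9/100`) for every
Lipschitz cylinder observable, along any DLR selection — hypothesis-free. -/
theorem su2_contDiffOn_infty_integral_9_25
    {μ : ℝ → Measure (LGConfig 4 (Matrix.specialUnitaryGroup (Fin 2) ℂ))}
    (hμ : ∀ βW ∈ Icc (0 : ℝ) (9 / 25), μ βW ∈ ymGibbsMeasures (d := 4) (fundamentalRep (Fin 2)) (2 * (βW / 4)))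
    {F : LGConfig 4 (Matrix.specialUnitaryGroup (Fin 2) ℂ) → ℝ} {Λ : Finset (ZdEdge 4)} {K : ℝ≥0}
    (hF : IsLipschitzCylinder (fundamentalRep (Fin 2)) F Λ K)
    {x₀ : Site 4} {D : ℕ} (hD : ∀ e ∈ Λ, ‖e.1 - x₀‖ ≤ D) :
    ContDiffOn ℝ ∞ (fun t => ∫ U, F U ∂(μ t)) (Ioo (0 : ℝ) (9 / 25)) :=
  su2_contDiffOn_infty_integral_star le_rfl hμ hF hD

/-- ★★ **The mean plaquette is `C^∞` on `(0, 9/25)`**: `u(β_W) = ⟨W_p⟩_{β_W}` is `ContDiffOn ℝ ∞` on `Ioo 0 (9/25)` for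
every plaquette `p`, along any DLR selection — no finite-order transition of the lattice internal energy inside the
window, as a kernel theorem. -/
theorem su2_contDiffOn_infty_plaquette_9_25
    {μ : ℝ → Measure (LGConfig 4 (Matrix.specialUnitaryGroup (Fin 2) ℂ))}
    (hμ : ∀ βW ∈ Icc (0 : ℝ) (9 / 25), μ βW ∈ ymGibbsMeasures (d := 4) (fundamentalRep (Fin 2)) (2 * (βW / 4)))
    (p : ZdPlaquette 4) :
    ContDiffOn ℝ ∞ (fun t => ∫ U, zdPlaquetteObs (fundamentalRep (Fin 2)) p.1 p.2.1.1 p.2.1.2 U ∂(μ t))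
      (Ioo (0 : ℝ) (9 / 25)) :=
  su2_contDiffOn_infty_integral_9_25 hμ (isLipschitzCylinder_zdPlaquetteObs (N := 2) p.1 p.2.2) (x₀ := p.1) (D := 1)
    (fun e he => by simpa using norm_fst_sub_le_of_mem_plaquetteEdges he)

/-- ★★ **The iterated derivatives of the mean plaquette**: `(d/dβ_W)ⁿ ⟨W_p⟩_{β_W} = Σ_q u_{n+1}(W_p; W_{q 0}; …)` at every
`0 < β_W < 9/25` — the higher plaquette susceptibilities of every order are the (finite) derivatives of the lattice
internal energy. -/
theorem su2_iteratedDeriv_plaquette_9_25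
    {μ : ℝ → Measure (LGConfig 4 (Matrix.specialUnitaryGroup (Fin 2) ℂ))}
    (hμ : ∀ βW ∈ Icc (0 : ℝ) (9 / 25), μ βW ∈ ymGibbsMeasures (d := 4) (fundamentalRep (Fin 2)) (2 * (βW / 4)))
    (p : ZdPlaquette 4) (n : ℕ) {βW : ℝ} (hb : βW ∈ Ioo (0 : ℝ) (9 / 25)) :
    iteratedDeriv n (fun t => ∫ U, zdPlaquetteObs (fundamentalRep (Fin 2)) p.1 p.2.1.1 p.2.1.2 U ∂(μ t)) βW =
      ∑' q : Fin n → ZdPlaquette 4,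
        trunc (μ βW) (zdPlaquetteObs (fundamentalRep (Fin 2)) p.1 p.2.1.1 p.2.1.2) 𝓦 q :=
  su2_iteratedDeriv_integral_eq le_rfl hμ (isLipschitzCylinder_zdPlaquetteObs (N := 2) p.1 p.2.2) (x₀ := p.1) (D := 1)
    (fun e he => by simpa using norm_fst_sub_le_of_mem_plaquetteEdges he) n hb

/-- ★★★ **`C^∞` without bookkeeping hypotheses**: for ANY Lipschitz cylinder observable `F` (any finite support) and any
DLR selection on `[0, 9/25]`, `β_W ↦ ⟨F⟩_{β_W}` is `C^∞` on `(0, 9/25)` (centre `x₀ = 0`, radius the largest base point). -/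
theorem su2_contDiffOn_infty_integral
    {μ : ℝ → Measure (LGConfig 4 (Matrix.specialUnitaryGroup (Fin 2) ℂ))}
    (hμ : ∀ βW ∈ Icc (0 : ℝ) (9 / 25), μ βW ∈ ymGibbsMeasures (d := 4) (fundamentalRep (Fin 2)) (2 * (βW / 4)))
    {F : LGConfig 4 (Matrix.specialUnitaryGroup (Fin 2) ℂ) → ℝ} {Λ : Finset (ZdEdge 4)} {K : ℝ≥0}
    (hF : IsLipschitzCylinder (fundamentalRep (Fin 2)) F Λ K) :
    ContDiffOn ℝ ∞ (fun t => ∫ U, F U ∂(μ t)) (Ioo (0 : ℝ) (9 / 25)) := by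
  classical
  refine su2_contDiffOn_infty_integral_9_25 hμ hF (x₀ := 0) (D := Λ.sup fun e => Site.supNorm e.1) fun e he => ?_
  rw [sub_zero, Site.norm_eq_supNorm]
  exact_mod_cast Finset.le_sup (f := fun e : ZdEdge 4 => Site.supNorm e.1) he

end Summit.Ventures.YMGap.CouplingResponse

end
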